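import Summits.CriticalPhenomena.Ising3DConformalLimit.Theses.FKParityRobustness
import Summits.CriticalPhenomena.Ising3DConformalLimit.Theorems.FKParityRobustnessDefs
import Summits.CriticalPhenomena.Ising3DConformalLimit.Theorems.FKParityRobustnessParityRobustMergingFKTransfer
import Literature.Combinatorics.SimpleGraph.CycleSpaceSeparators
import Literature.Probability.LatticeModels.CriticalTwoPointLower
import Literature.Probability.LatticeModels.ModifiedSimonInequality

/-!
# Disproof of `IndependentStrandsJoin` (stmt-CriticalPhenomena-14625, route FKParityRobustness) — findings

Standing disprover `refuter-cdisprove-stmt-CriticalPhenomena-14625-0`, cycle 1 (2026-08-16).  The crux: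
`∃ c > 0, ∀ l ≥ 1, ∃ N₀, ∀ N ≥ N₀`, for the tetrahedron `a = l • tetra ⊂ Λ_N` and `t = t_c = tanh β_c(3)`,
`c·Z(a₀a₁)·Z(a₂a₃) ≤ jointSum := Σ_{F₁ ∈ 𝒯(a₀a₁)} Σ_{F₂ ∈ 𝒯(a₂a₃)} t^{|F₁|+|F₂|} 1[a₀ ↔ a₂ in F₁ ∪ F₂]`
(two INDEPENDENT critical sourced loop-O(1) configurations join the tetrahedron across, `ℓ ⊗ ℓ`-probability
`≥ c`).  VERDICT OF CYCLE 1: NO KILL — the crux is EQUIVALENT to uniform tetrahedral non-Gaussianity (§ B),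
which the conformal bootstrap puts at `Q = 0.683` and this seat's exact-in-law MC confirms on the lattice
(`q_∞ ≈ 0.46–0.48 = c`, flat in `l` for `l ≤ 16`, § C); no Lean-level counterexample exists; everything
conclusive is proved sorry-free and the two negative-lemma files are LANDED (p85405, p91361).  Numbers, not
adjectives:

* § 0 ELABORATION / READ-BACK.  rc 0 (W.lean).  `box 3 N = {-N,…,N}³` (`Fintype.piFinset`), `G_N =
  (zdGraph 3).comap Subtype.val`, `t_c = tanh (sInf {β ≥ 0 | m*(β) > 0}) > 0` (`criticalBeta_pos_holds`,
  `tanh_criticalBeta_pos`), `Z = loopO1PartitionFunction = Σ_{F ∈ tJoins} t^{|F|}`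
  (`loopO1PartitionFunction_eq_sum_tJoins`).  No junk operators (no `/`, no `ℕ`-subtraction, no `tsum`,
  no `sSup`); quantifier order = the informal text; `a` exists iff `l ≤ N`.  General finite-graph facts:
  `jointSum ≤ Z·Z` (`jointSum_le_mul`, so `c ≤ 1`: `c_le_one_of_strandsJoin_bound`); `𝒯({x}) = ∅`
  (`tJoins_singleton_eq_empty`, handshake); every `T`-join of a pair JOINS the pair
  (`reachable_of_mem_tJoins_pair`), hence the crux's event `a₀ ↔ a₂ in F₁ ∪ F₂` IS "all four sources in
  one component" (`reachable_cross_iff_joinsAll`): the mutation "all joined" is not a strengthening, and the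
  choice of the cross pair `(a₀,a₂)` is immaterial.
* § A LOAD-BEARING HYPOTHESES.  `1 ≤ l`: NOT load-bearing (`independentStrandsJoinWithoutHl_iff`; at `l = 0`
  both sides vanish).  `0 < c`: dropping it makes the crux trivial (`independentStrandsJoinWithoutHc_holds`).
  `∃ c` BEFORE `∀ l`: THE content — the per-scale statement `IndependentStrandsJoinPerScale` is TRUE with
  `c(l) = (t_c/(1+t_c))^{8l}` (paper proof in its docstring: force `F₂ ⊇ γ`, `γ` an explicit `8l`-edge path
  `a₂ → a₀ → a₃`; `Z⁰(G)/Z⁰(G-e) ≤ 1+t`), uniformly in `N ≥ l`; so the `N → ∞` limit is harmless and every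
  counterexample must be an `l → ∞` decay of `jointSum/(Z·Z)`.
* § A″ THE PER-SCALE TOOLKIT (Lean, sorry-free, positive helpers): `xor_transport_le`,
  `forcing_decomposition`, `edge_deletion_le` — the general finite-graph inequalities of the per-scale
  proof (only the explicit lattice paths are left out); reusable finite-energy tools for `ℓ^S`.
* § A′ NATURAL STRENGTHENING REFUTED (Lean, sorry-free; LANDED as
  `Theorems/IndependentStrandsJoin/Negative/GraphUniform.lean`, p85405 accepted 08:22Z; the load-bearing lemmas of
  § 0/§ A LANDED as `…/Negative/LoadBearing.lean`, p91361 accepted 08:44Z): NO GRAPH-UNIFORM CONSTANT —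
  `not_graphUniformStrandsJoin` (at `t_c`) / `not_graphUniformStrandsJoin_at` (every `t > 0`): on the connected
  path `0–1–2–3` with sources `(0,1,2,3)` parity expels the middle edge from both strands, `jointSum = 0 <
  c·t² ≤ c·Z·Z`.  The route's supports (`StrandsJoinBound`, `DepletionBound`) ARE graph-uniform; the crux is
  where `Λ_N ⊂ ℤ³` must enter.
* § B TARGETS — line `Sketch` (lead prover-line-stmt-CriticalPhenomena-14625-0; 7 stubs registered 06:30Z:
  `stub_depletionBound`, `stub_pairSplit`, `stub_separation`, `stub_symmetry`, `stub_boxSymmetry`,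
  `stub_tetraU4Lattice`, `stub_transfer`).  VERDICT: all TRUE, none misstated (edge cases `t = 0` and
  disconnected pairs checked) — proofs sketched in the § B docstrings; nothing to break.  KEY FINDING: the
  line is an exact REFORMULATION, not a reduction: its finite stubs give, on every finite graph carrying
  the two tetrahedral automorphisms, `jointSum ≥ jointSum_K ≥ -U₄·Z_∅²/3` (`jointSum_K` = cluster-touch
  version), while `StrandsJoinBound` gives `jointSum ≤ -U₄·Z_∅²/2`; hence `stub_tetraU4Lattice ⟺ crux`
  (`c_{U4} ≥ 2·c_crux`: Lean, `tetraU4Lattice_of_crux`, § B; `c_crux ≥ c_{U4}/3`: the line).  The only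
  content-bearing stub IS the crux = finite-volume tetrahedral non-Gaussianity `U₄(A_l) ≤ -c·G₀₁G₂₃`, i.e.
  clause (iii) on tetrahedra: the route's "one inclusion below (iii)" is rigorously truth-EQUIVALENT to
  (iii)|tetrahedra.  Quantitative corollary of § C: `2q ≤ R₄ := -U₄/(G₀₁G₂₃) ≤ 3q_K`, so with the
  infinite-volume values `q_∞ ≈ 0.46–0.48`, `q_K,∞ ≈ 0.45–0.47` (§ C (iii)): `R₄(A_l) ∈ [0.92, 1.4]`.
  CONFORMAL-BOOTSTRAP CROSS-CHECK (READ: Rychkov–Simmons-Duffin–Zan, SciPost Phys. 2 (2017) 001,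
  arXiv:1612.02436, p. 2 and App. B): the non-Gaussianity ratio `Q = ⟨σσσσ⟩/(three Wick pairings)` of the 3d
  Ising CFT attains its MINIMUM `Q_min = 0.683` (`0.68283 → 0.68266` under spectrum truncation `Δ < 8`) exactly
  at `z_± = 1/2 ± i√3/2`, `u = v = 1` — "four points equally spaced at the corners of a tetrahedron" — and on
  the lattice `Q = 1/(1+2p)`, `p` = Aizenman's `(A,∅)`-sourced double-current connection probability (their
  eq. (B.9), = the tree's switching identity), `1/3 ≤ Q ≤ 1` (Lebowitz–Aizenman).  Hence at the regular
  tetrahedron `R₄^{CFT} = 3(1 - Q_min) = 0.951` and the pair-sourced double-current connection probability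
  (clause (iii)'s quantity) is `P^{01}⊗P^{23}[joined] = R₄/2 = 0.476`.  CONSISTENT with this seat's lattice
  sandwich `0.92 ≲ R₄ ≲ 1.4`, and SHARP at the upper end: the saturated `q_∞ = 0.478(4)` at `l = 1`
  (`≈ 0.46` on the scaling curve) sits AT the ceiling `R₄/2 = 0.476` (lattice corrections at small `l` of a few
  per cent) — the two independent ODD PARTS realise essentially ALL of the double-current connection at the
  tetrahedron: the "one inclusion below (iii)" costs a few per cent at most, never the sign; and
  `q_K,∞ ≈ 0.46 ≥ R₄/3 = 0.317`.  BOTTOM LINE FOR A DISPROVER: the crux is equivalent to `Q(tetrahedron) < 1`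
  uniformly in the lattice scale, and the bootstrap puts `Q = 0.683`, a `32 %` effect stable to `10⁻⁴`; refuting
  the crux would refute the conformal-bootstrap solution of 3d Ising as the scaling limit.  No kill exists.
* § C NUMERICS (this seat; kit jobs auto-attach to the item; sampler = Swendsen–Wang for FK(`p_c`,2) on
  the torus `ℤ³_L` + the sourced Grimmett–Janson dictionary: given `ω` with `x ↔ y` in `ω`, a UNIFORM
  `T`-join of `{x,y}` inside `ω` has law `ℓ^{xy}_t`, `t = p/(2-p) = tanh β` — uniform `T`-join = uniform even
  subgraph of `ω` (random chords of a spanning forest, completed along the forest) XOR the forest path; two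
  independent chains, all translations of `A_l` as placements, ratio estimator, block jackknife; EXACT IN LAW,
  self-test: the two-copy value on the cube `Q₃` with alternate corners by enumeration is `0.252273`
  (= prior seat's `0.25227`, an independent check of the read-back) and the sampler gives `0.251(6)`).
  MEASURED `q = ℓ⊗ℓ[a₀ ↔ a₂ in F₁ ∪ F₂]` (THE crux event), `q_K = P[V(K₁) ∩ V(K₂) ≠ ∅] ≤ q`, `|V(K₁)|`:
  (i) FIXED ASPECT RATIO `L = 8l` (j013933, done 08:11Z; `l = 2,3,4,6,8,12,16`, `L = 16…128`; pairs
  `66730/60463/12826/10656/4389/1432/510`): `q = 0.6795(24) / 0.6782(27) / 0.6720(36) / 0.6848(64) / 0.6752(129)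
  / 0.6874(156) / 0.6763(185)` — FLAT over a factor `8` in `l` (log-slope `2 → 16`: `-0.003(14)`; every local
  slope within `1σ` of `0`); `q_K = 0.658 / 0.652 / 0.642 / 0.650 / 0.638 / 0.649 / 0.632`; source-cluster mass
  `|V(K₁)| = 133.6 / 272.9 / 439.3 / 925.9 / 1466 / 3060 / 5018 ∝ l^{1.744}` (`2 → 16`) — a direct measurement
  of `D_HT` consistent with `3 - Δ_T = 1.7346`; two-point proxy `τ(2√2 l) ∝ l^{-1.04}` (`= -(1+η)`, SW sanity);
  (`l = 1`, ratio `12`: `0.6164(19)`);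
  (ii) FIXED `l`, GROWING `L` (j014437): `l = 2`: `L = 16/24/32/48/64 → q = 0.683(10)/0.604(5)/0.558(5)/
  0.515(6)/0.493(7)` (`q_K = .661/.583/.540/.499/.479`; `|V(K₁)| = 135/205/277/388/475`, growing like
  `L^{0.6–0.85}`: the MEAN source-cluster mass is dominated by critical soup clusters glued to the strand that
  reach the system scale); `l = 4`: `L = 32/48/64 → q = 0.672(5)/0.611(14)/0.552(17)`; `l = 1`: `L = 12 →
  0.617(1)`.  SCALING: `q = g(l/L)` within errors (`l = 1, 2, 4` agree at equal ratio): `g(1/8) = 0.68`,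
  `g(1/12) = 0.61`, `g(1/16) = 0.555`, `g(1/24) = 0.515`, `g(1/32) = 0.49`.  So the torus ENHANCES joining and
  the flatness in (i) is scale invariance at fixed ratio, NOT yet the crux: the crux takes `N → ∞` FIRST, i.e.
  needs `g(0⁺) := lim_{x→0} g(x) > 0`.  Local slopes of `log g` vs `log(L/l)`: `-0.30(5), -0.27(6), -0.20(4),
  -0.15(6)` over ratios `8→12→16→24→32` — decreasing in magnitude (concave): SATURATION, not a power law (a pure
  `g ∝ x^κ` would need `κ` drifting `0.30 → 0.15`).  MECHANISM (zero mode): on the critical torus a fraction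
  `≍ (r/L)^{1+η}` (`r = 2√2·l`, `1 + η = 1.036`) of the conditioning events `a₀ ↔ a₁ in ω` are carried by an
  FK cluster of linear size `≍ L`; there the uniform `T`-join — hence `K₁` — spreads over the whole torus and
  meets the other copy almost surely.  The one-parameter family `g(x) = g₀ + A·x^{1.036}` fits ALL points:
  `g₀ = 0.43`, `A = 2.2` gives `0.68 / 0.60 / 0.553 / 0.511 / 0.490` at ratios `8/12/16/24/32` (measured
  `0.68 / 0.61 / 0.555 / 0.515 / 0.49`).  So the infinite-volume (= the crux's `N → ∞`) two-copy joining
  probability is `g₀ ≈ 0.43(3)` by this fit (the DIRECT measurement (iii) below saturates higher, `≈ 0.46–0.48`: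
  the approach is steeper than `x^{1.036}` beyond ratio `32`) — POSITIVE and `l`-independent, as the second-moment
  count at scale `l` predicts (`2D_HT - 3 = +0.47`, § D); `lim inf_N q_N(l) ≥ c(l) > 0` for EACH `l` is anyway
  a theorem (§ A), so only the `l`-uniformity of `g₀` is at stake — exactly the crux, and the data show no
  drift of `g` with `l` at fixed ratio (`l = 1…6`).
  (iii) SATURATION TEST (pre-registered 06:41Z before the data; j014979 done 09:20Z; `l = 1`, `L = 16/24/32/48/
  64/96/96/128/128`, two independent seeds at `96` and `128`; pairs `35622/20560/17727/10045/3981/1292+1277/495+469`,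
  `n_valid` up to `1.3·10⁷`): `q = 0.5746(17) / 0.5285(17) / 0.5133(20) / 0.4925(19) / 0.4797(30) / 0.4769(33) /
  0.4780(43)` (seeds combined at `96`, `128`; the two seeds agree within `1σ`); log-slopes vs `L`: `-0.21, -0.10,
  -0.10, -0.09, -0.014(23), +0.008(40)` — the curve FLATTENS and is constant for `L/l ≥ 64`: SATURATION at
  `q_∞(l=1) = 0.478(4)` (`q_K,∞ = 0.472(4)`).  The pre-registered alternative "continued power decay `κ ≈ 0.2`"
  predicted `0.447 / 0.422` at `L = 96 / 128` and is excluded at `> 7σ / > 10σ`; the pre-registered saturation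
  criterion (`q(1;128) ≥ 0.44` with flattening slopes) is met.  So `lim_N q_N(l)` is a POSITIVE constant
  `≈ 0.46–0.48` (`l = 1` sits `≈ 4 %` above the scaling curve), reached for `N/l ≳ 50`, and by (i) it does not
  drift with `l` up to `l = 16`: numerically the crux holds with `c ≈ 0.46`.  Against the bootstrap ceiling
  `q ≤ P^{01}⊗P^{23}[joined] = R₄/2 = 0.476` (§ B): the two independent ODD PARTS realise essentially ALL of the
  double-current connection at the tetrahedron (`q_∞/P_pair ≈ 0.97–1.0`; the earlier model-based extrapolation
  `g₀ ≈ 0.43` from ratios `≤ 32` was `≈ 7 %` low) — the "one inclusion below (iii)" costs a few per cent at most.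
  Other seats:
  literal free boxes `l ≤ 5` = j012868 (refuter-rattack), ideator-2 control `q_K(l ≤ 12)` = j008293–5 (item
  11253) — not attached as of 06:40Z.  Never a Lean refutation either way.
* § D WHY IT RESISTS, AND WHERE IT COULD STILL BREAK.  By § A the crux is exactly the `l`-uniform positivity
  of `q(l) = ℓ^{a₀a₁} ⊗ ℓ^{a₂a₃}[K₁ ↔ K₂]`; by § B it is EQUIVALENT to `l`-uniform tetrahedral non-Gaussianity
  `Q(A_l) ≤ 1 - c'` (`R₄/3 ≤ q ≤ R₄/2`), i.e. to a strict, uniform Lebowitz inequality at `β_c` — the only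
  rigorous bounds being `1/3 ≤ Q ≤ 1` (Aizenman / Lebowitz, every graph, every `β`); its negation would be
  tetrahedral Gaussianity `Q(A_l) → 1`, against `Q^{CFT} = 0.683`.  Second-moment heuristic: two independent fractals of dimension
  `D` at mutual distance `≍` their size meet with probability `Θ(1)` iff `2D > 3` (`E N ≍ l^{2D-3}`,
  `E N² ≍ (E N)²` under quasi-multiplicativity); `D_HT = 3 - Δ_T(n=1) = 1.7346(5)` (conformal bootstrap,
  Shimada–Hikami 2016), `1.7349(65)` (HT-graph cluster dimension at `K_c`, Winter–Janke–Schakel 2008),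
  `1.734(4)` (worm): `2D_HT - 3 = +0.47`, forty standard deviations from the threshold — predicted TRUE.
  Regime scan (each a necessary feature of any proof): `t < t_c` FALSE (subcritical strands are
  Ornstein–Zernike diffusive tubes around two skew segments at distance `2l ≫ √l`: meeting probability
  `≤ e^{-cl}`) ⇒ criticality must be used, no `t`-uniform HT argument; `d ≥ 4` FALSE (ADC 2021 Prop. 1.4,
  `(log L)^{-c}` avoidance of independent current clusters, a fortiori of odd parts; barrier
  `IsingTrivialityFromDimensionFour`, complied) ⇒ `d = 3` must be used; `d = 2` analogue TRUE for the planar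
  reason (diagonals of a square cross; Aizenman 1982); graph-uniform FALSE (§ A′); per-scale TRUE (§ A).
  Rigorous window: `|V(K₁)| ≥ c·l` (a strand spans the edge) and `E|V(K₁)| ≤ Σ_z τ(a₀z)τ(za₁)/τ(a₀a₁) ≍
  l^{2-η}` (source cluster ⊆ double-current cluster, switching) give `D_HT ∈ [1, 2-η] ∋ 3/2`: NEITHER the crux
  (`D_HT > 3/2` + quasi-multiplicativity) NOR its negation (`D_HT < 3/2`, or a specific odd-part avoidance
  mechanism — none known; WJS08: HT graphs percolate exactly at `T_c` with standard scaling) is within reach of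
  any inequality in the tree or in print.  A Lean refutation is therefore impossible today; a numerical one
  would need `q(l)` to DECAY, against a `0.47` exponent margin.  Residual risks recorded for the MC readers:
  (a) a source cluster much thinner than generic HT clusters (strand-dominated dust) — but `3 - Δ_T` IS the
  strand (2-leg) dimension; (b) boundary effects — excluded at fixed `l` by § A; (c) small-`l` lattice
  artefacts — irrelevant to `∃ c`.
* § E NEAR-MISSES.  None: no `sorry` in this file.  Not attempted in Lean (cost ≫ value): the "sure join"
  strengthening `c = 1` on the literal box (false as soon as two vertex-disjoint `T`-joins exist, e.g. the two
  planar L-paths at `z = -l` and `z = +l`; needs explicit `T`-joins of `G_N` for symbolic `N`).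
-/

noncomputable section

open Finset
open Literature.Probability.LatticeModels
open Literature.Combinatorics.SimpleGraph.CycleSpace
open Summit.CriticalPhenomena.Ising3DConformalLimit.Cruxes.ParityRobustMerging.PlaquetteXorSurgery
  (tetra tetra_inj tetra_injective tanh_criticalBeta_nonneg JoinsAll symmDiff_mem_tJoins)
open Summit.CriticalPhenomena.Ising3DConformalLimit.Theses.FKParityRobustness
  (IndependentStrandsJoin StrandsJoinBound)

namespace Summit.CriticalPhenomena.Ising3DConformalLimit.Cruxes.IndependentStrandsJoin.Disproof

open scoped Classical

/-! ## § 0. The objects of the crux on a general finite graph -/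

section General

variable {V : Type*} [Fintype V] [DecidableEq V] (G : SimpleGraph V) [DecidableRel G.Adj]

/-- The JOINT SUM of the crux (its right-hand side, verbatim up to the ambient graph):
`Σ_{F₁ ∈ 𝒯(a₀a₁)} Σ_{F₂ ∈ 𝒯(a₂a₃)} t^{|F₁|+|F₂|}·1[a₀ ↔ a₂ in F₁ ∪ F₂]`. -/
def jointSum (t : ℝ) (a : Fin 4 → V) : ℝ :=
  ∑ F₁ ∈ tJoins G Set.univ {a 0, a 1}, ∑ F₂ ∈ tJoins G Set.univ {a 2, a 3},
    if (SimpleGraph.fromEdgeSet ((↑F₁ : Set (Sym2 V)) ∪ ↑F₂)).Reachable (a 0) (a 2)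
      then t ^ (#F₁ + #F₂) else 0

/-- `Z^A_t(G) = Σ_{F ∈ 𝒯_A} t^{|F|}` (the tree's `loopO1PartitionFunction` as a sum over `tJoins`). [folklore] -/
theorem loopO1PartitionFunction_eq_sum_tJoins (t : ℝ) (A : Finset V) :
    loopO1PartitionFunction G t A = ∑ F ∈ tJoins G Set.univ A, t ^ #F := by
  unfold loopO1PartitionFunction loopO1Weight
  rw [← Finset.sum_filter]
  refine Finset.sum_congr ?_ fun _ _ => rfl
  ext F
  simp only [Finset.mem_filter, Finset.mem_powerset]
  exact ⟨fun h => h.2, fun h => ⟨((mem_tJoins G).1 h).1, h⟩⟩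

/-- The joint sum is nonnegative for `t ≥ 0`. [folklore] -/
theorem jointSum_nonneg {t : ℝ} (ht : 0 ≤ t) (a : Fin 4 → V) : 0 ≤ jointSum G t a := by
  unfold jointSum
  refine Finset.sum_nonneg fun F₁ _ => Finset.sum_nonneg fun F₂ _ => ?_
  split_ifs
  · positivity
  · exact le_rfl

/-- **Tightness of the constant**: the joint sum never exceeds `Z(a₀a₁)·Z(a₂a₃)` (drop the indicator),
so any admissible constant of the crux satisfies `c ≤ 1` as soon as the two partition functions are
positive (`c_le_one_of_strandsJoin_bound`). [folklore] -/
theorem jointSum_le_mul {t : ℝ} (ht : 0 ≤ t) (a : Fin 4 → V) :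
    jointSum G t a ≤ loopO1PartitionFunction G t {a 0, a 1} * loopO1PartitionFunction G t {a 2, a 3} := by
  rw [loopO1PartitionFunction_eq_sum_tJoins, loopO1PartitionFunction_eq_sum_tJoins, Finset.sum_mul_sum]
  unfold jointSum
  refine Finset.sum_le_sum fun F₁ _ => Finset.sum_le_sum fun F₂ _ => ?_
  split_ifs
  · rw [pow_add]
  · positivity

/-- `c ≤ 1` is forced: if `c·Z₁·Z₂ ≤ jointSum` with `Z₁·Z₂ > 0` then `c ≤ 1`. [folklore] -/
theorem c_le_one_of_strandsJoin_bound {t c : ℝ} (ht : 0 ≤ t) (a : Fin 4 → V)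
    (hZ : 0 < loopO1PartitionFunction G t {a 0, a 1} * loopO1PartitionFunction G t {a 2, a 3})
    (h : c * loopO1PartitionFunction G t {a 0, a 1} * loopO1PartitionFunction G t {a 2, a 3} ≤ jointSum G t a) :
    c ≤ 1 := by
  have := h.trans (jointSum_le_mul G ht a)
  rw [mul_assoc] at this
  by_contra hc
  have hc' : 1 < c := not_le.mp hc
  nlinarith

/-- **Handshake**: no `T`-join has a single source (`tJoins G ω {x} = ∅`). [folklore] -/
theorem tJoins_singleton_eq_empty (ω : Set (Sym2 V)) (x : V) : tJoins G ω {x} = ∅ := by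
  refine Finset.eq_empty_iff_forall_notMem.2 fun F hF => ?_
  obtain ⟨hFG, -, hpar⟩ := (mem_tJoins G).1 hF
  have hFE : ∀ e ∈ F, ¬ e.IsDiag := fun e he =>
    SimpleGraph.not_isDiag_of_mem_edgeSet G (SimpleGraph.mem_edgeFinset.1 (hFG he))
  have hx : Odd (edgeDeg F x) := (hpar x).2 (Finset.mem_singleton_self x)
  obtain ⟨w, hw, -, hwodd⟩ := exists_reachable_odd_of_odd F hFE hx
  exact hw (Finset.mem_singleton.1 ((hpar w).1 hwodd))

/-- Hence `Z^{{x}} = 0`: coincident sources kill the partition function. [folklore] -/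
theorem loopO1PartitionFunction_singleton (t : ℝ) (x : V) : loopO1PartitionFunction G t {x} = 0 := by
  rw [loopO1PartitionFunction_eq_sum_tJoins, tJoins_singleton_eq_empty, Finset.sum_empty]

/-- **A `T`-join of a pair joins the pair**: if `∂F = {x, y}` with `x ≠ y` then `x ↔ y` in `F`
(handshake in the component of `x`). So the strand of `ℓ^{xy}` is always there; only the MEETING of
two independent strands is at stake in the crux. [folklore] -/
theorem reachable_of_mem_tJoins_pair {ω : Set (Sym2 V)} {x y : V} {F : Finset (Sym2 V)}
    (hF : F ∈ tJoins G ω {x, y}) : (SimpleGraph.fromEdgeSet (↑F : Set (Sym2 V))).Reachable x y := by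
  by_cases hxy : x = y
  · subst hxy; exact SimpleGraph.Reachable.refl _
  obtain ⟨hFG, -, hpar⟩ := (mem_tJoins G).1 hF
  have hFE : ∀ e ∈ F, ¬ e.IsDiag := fun e he =>
    SimpleGraph.not_isDiag_of_mem_edgeSet G (SimpleGraph.mem_edgeFinset.1 (hFG he))
  have hx : Odd (edgeDeg F x) := (hpar x).2 (by simp)
  obtain ⟨w, hw, hreach, hwodd⟩ := exists_reachable_odd_of_odd F hFE hx
  have hw' : w ∈ ({x, y} : Finset V) := (hpar w).1 hwodd
  rw [Finset.mem_insert, Finset.mem_singleton] at hw'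
  rcases hw' with rfl | rfl
  · exact absurd rfl hw
  · exact hreach

/-- **Mutation "all four joined" ≡ the crux's event.**  For `F₁ ∈ 𝒯(a₀a₁)`, `F₂ ∈ 𝒯(a₂a₃)` the
crux's indicator `a₀ ↔ a₂ in F₁ ∪ F₂` is EQUIVALENT to "all four sources in one component of
`F₁ ∪ F₂`" (the `JoinsAll` of the sibling crux BLOB): each strand joins its own pair
(`reachable_of_mem_tJoins_pair`).  In particular the asymmetric-looking choice of the pair `(a₀, a₂)`
in the crux is immaterial (any cross pair gives the same event). [folklore] -/
theorem reachable_cross_iff_joinsAll {ω : Set (Sym2 V)} (a : Fin 4 → V) {F₁ F₂ : Finset (Sym2 V)}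
    (h₁ : F₁ ∈ tJoins G ω {a 0, a 1}) (h₂ : F₂ ∈ tJoins G ω {a 2, a 3}) :
    (SimpleGraph.fromEdgeSet ((↑F₁ : Set (Sym2 V)) ∪ ↑F₂)).Reachable (a 0) (a 2) ↔
      ∀ i j, (SimpleGraph.fromEdgeSet ((↑F₁ : Set (Sym2 V)) ∪ ↑F₂)).Reachable (a i) (a j) := by
  set H := SimpleGraph.fromEdgeSet ((↑F₁ : Set (Sym2 V)) ∪ ↑F₂) with hH
  have h01 : H.Reachable (a 0) (a 1) :=
    (reachable_of_mem_tJoins_pair G h₁).mono (SimpleGraph.fromEdgeSet_mono Set.subset_union_left)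
  have h23 : H.Reachable (a 2) (a 3) :=
    (reachable_of_mem_tJoins_pair G h₂).mono (SimpleGraph.fromEdgeSet_mono Set.subset_union_right)
  refine ⟨fun h02 => ?_, fun h => h 0 2⟩
  have h0 : ∀ i, H.Reachable (a 0) (a i) := by
    intro i
    fin_cases i
    · exact SimpleGraph.Reachable.refl _
    · exact h01
    · exact h02
    · exact h02.trans h23
  exact fun i j => (h0 i).symm.trans (h0 j)

/-- The same equivalence with the sibling crux's predicate `JoinsAll a (F₁ ∪ F₂)` (coercion of a
`Finset` union). [folklore] -/
theorem reachable_cross_iff_joinsAll' {ω : Set (Sym2 V)} (a : Fin 4 → V) {F₁ F₂ : Finset (Sym2 V)}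
    (h₁ : F₁ ∈ tJoins G ω {a 0, a 1}) (h₂ : F₂ ∈ tJoins G ω {a 2, a 3}) :
    (SimpleGraph.fromEdgeSet ((↑F₁ : Set (Sym2 V)) ∪ ↑F₂)).Reachable (a 0) (a 2) ↔ JoinsAll a (F₁ ∪ F₂) := by
  rw [reachable_cross_iff_joinsAll G a h₁ h₂, JoinsAll, Finset.coe_union]

end General

/-! ## § A. Load-bearing analysis of the crux (box setting)

The crux has the shape `∃ c > 0, ∀ l ≥ 1, ∃ N₀, ∀ N ≥ N₀, ∀ a = l • tetra, c·Z(a₀a₁)·Z(a₂a₃) ≤ jointSum`.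
Hypotheses, one at a time:

* `0 < c` — dropping it makes the statement TRIVIAL (`independentStrandsJoinWithoutHc_holds`, `c = 0`):
  all the content is in the positivity of ONE constant.
* `1 ≤ l` — NOT load-bearing (`independentStrandsJoinWithoutHl_iff`): at `l = 0` the four sources
  coincide at the origin, `{a₀, a₁} = {a₀}`, `𝒯({a₀}) = ∅` by the handshake lemma, both sides vanish.
  (Contrast: for the sibling crux BLOB `1 ≤ l` IS load-bearing, `parityRobustMerging_false_without_hl`.)
* `∃ N₀` — for `N < l` the source map `a` does not exist (vacuous), so the variant "`∀ N`" only adds the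
  boxes `l ≤ N < N₀(l)`; predicted equally true, not decidable here.
* `∃ c` BEFORE `∀ l` (uniformity in the scale) — THE load-bearing structure: the per-scale statement
  `IndependentStrandsJoinPerScale` (`∀ l, ∃ c(l) > 0, …`) is TRUE, with `c(l) = (t_c/(1+t_c))^{8l}`
  (paper proof in its docstring; positive statement, not landed by this seat), so every counterexample
  to the crux must be an `l → ∞` phenomenon: `jointSum/(Z·Z) → 0` along a sequence of scales.
-/

/-- The crux with the hypothesis `1 ≤ l` DROPPED (everything else verbatim). -/
def IndependentStrandsJoinWithoutHl : Prop :=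
  let tetra : Fin 4 → Literature.Probability.LatticeModels.Site 3 := ![![-1, -1, -1], ![1, 1, -1], ![1, -1, 1], ![-1, 1, 1]]; ∃ c : ℝ, 0 < c ∧ ∀ l : ℕ, ∃ N₀ : ℕ, ∀ N : ℕ, N₀ ≤ N → ∀ a : Fin 4 → ↥(Literature.Probability.LatticeModels.box 3 N), (∀ i, ((a i : Literature.Probability.LatticeModels.Site 3)) = (l : ℤ) • tetra i) → (let G := ((Literature.Probability.LatticeModels.zdGraph 3).comap (Subtype.val : ↥(Literature.Probability.LatticeModels.box 3 N) → Literature.Probability.LatticeModels.Site 3)); let t : ℝ := Real.tanh (Literature.Probability.LatticeModels.criticalBeta 3); c * Literature.Probability.LatticeModels.loopO1PartitionFunction G t {a 0, a 1} * Literature.Probability.LatticeModels.loopO1PartitionFunction G t {a 2, a 3} ≤ ∑ F₁ ∈ Literature.Probability.LatticeModels.tJoins G Set.univ {a 0, a 1}, ∑ F₂ ∈ Literature.Probability.LatticeModels.tJoins G Set.univ {a 2, a 3}, if (SimpleGraph.fromEdgeSet ((↑F₁ : Set (Sym2 ↥(Literature.Probability.LatticeModels.box 3 N))) ∪ ↑F₂)).Reachable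 (a 0) (a 2) then t ^ (F₁.card + F₂.card) else 0)

/-- The crux with the hypothesis `0 < c` DROPPED (everything else verbatim). -/
def IndependentStrandsJoinWithoutHc : Prop :=
  let tetra : Fin 4 → Literature.Probability.LatticeModels.Site 3 := ![![-1, -1, -1], ![1, 1, -1], ![1, -1, 1], ![-1, 1, 1]]; ∃ c : ℝ, ∀ l : ℕ, 1 ≤ l → ∃ N₀ : ℕ, ∀ N : ℕ, N₀ ≤ N → ∀ a : Fin 4 → ↥(Literature.Probability.LatticeModels.box 3 N), (∀ i, ((a i : Literature.Probability.LatticeModels.Site 3)) = (l : ℤ) • tetra i) → (let G := ((Literature.Probability.LatticeModels.zdGraph 3).comap (Subtype.val : ↥(Literature.Probability.LatticeModels.box 3 N) → Literature.Probability.LatticeModels.Site 3)); let t : ℝ := Real.tanh (Literature.Probability.LatticeModels.criticalBeta 3); c * Literature.Probability.LatticeModels.loopO1PartitionFunction G t {a 0, a 1} * Literature.Probability.LatticeModels.loopO1PartitionFunction G t {a 2, a 3} ≤ ∑ F₁ ∈ Literature.Probability.LatticeModels.tJoins G Set.univ {a 0, a 1}, ∑ F₂ ∈ Literature.Probability.LatticeModels.tJoins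 G Set.univ {a 2, a 3}, if (SimpleGraph.fromEdgeSet ((↑F₁ : Set (Sym2 ↥(Literature.Probability.LatticeModels.box 3 N))) ∪ ↑F₂)).Reachable (a 0) (a 2) then t ^ (F₁.card + F₂.card) else 0)

/-- The PER-SCALE crux: the constant may depend on the scale `l` (`∀ l, ∃ c(l) > 0, …`; everything
else verbatim).  TRUE, by an ELEMENTARY argument (pure XOR transport on `T`-joins plus `0 < t_c ≤ 1`;
no correlation inequality, no infinite volume; uniform in `N ≥ l`; positive statement, not landed by
this seat — the general-graph lemmas it needs are `symmDiff_mem_tJoins` (tree, FKTransfer file) and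
the three displayed below):
let `γ` be the self-avoiding lattice path `a₂ = (l,-l,l) → (-l,-l,l) → (-l,-l,-l) = a₀ → (-l,l,-l) →
(-l,l,l) = a₃` (four axis-parallel legs, `8l` edges, inside `Λ_l ⊆ Λ_N`), so `∂γ = {a₂,a₃}` and `a₀ ∈ V(γ)`.
(1) FORCING DECOMPOSITION: `F₂ ↦ F₂ ∖ γ` is a bijection `{F₂ ∈ 𝒯_{a₂a₃}(G) : F₂ ⊇ γ} → 𝓔_∅(G ∖ γ)`
(degrees add on disjoint edge sets), so `Σ_{F₂ ⊇ γ} t^{|F₂|} = t^{8l}·Z_∅(G ∖ γ)`.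
(2) EDGE DELETION + XOR TRANSPORT: for an edge `e = uv`, `Z_A(H) = Z_A(H - e) + t·Z_{A∆{u,v}}(H - e)`, and
for ANY `u–v` path `P ⊆ H - e`, `F ↦ F ∆ P` injects `𝒯_{A∆{u,v}}(H-e)` into `𝒯_A(H-e)` with
`|F ∆ P| ≤ |F| + |P|`, whence (`t ≤ 1`) `t^{|P|}·Z_{A∆{u,v}}(H-e) ≤ Z_A(H-e)` and
`Z_A(H) ≤ (1 + t^{1-|P|})·Z_A(H - e)`.  Every edge of `γ` has a 3-edge detour (a plaquette on `e` chosen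
away from the other legs of `γ`, inside `Λ_N`), so deleting the `8l` edges of `γ` one at a time:
`Z_∅(G) ≤ (1 + t^{-2})^{8l}·Z_∅(G ∖ γ)`.
(3) XOR TRANSPORT again with an `a₂–a₃` lattice path `Q` of `4l` edges (inside `Λ_N`; e.g. along the
top face): `t^{4l}·Z_{a₂a₃}(G) ≤ Z_∅(G)`.
Chain: `Σ_{F₂ ⊇ γ} t^{|F₂|} = t^{8l} Z_∅(G∖γ) ≥ t^{8l}(1+t^{-2})^{-8l} Z_∅(G) ≥ t^{12l}(1+t^{-2})^{-8l}
Z_{a₂a₃}(G)`; on `{F₂ ⊇ γ}` the path `γ ∋ a₀` joins `a₂` to `a₀` inside `F₂`, so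
`jointSum ≥ Z(a₀a₁)·Σ_{F₂ ⊇ γ} t^{|F₂|} ≥ c(l)·Z(a₀a₁)·Z(a₂a₃)` with
`c(l) = (t_c^{12}/(1+t_c^{-2})^{8})^{l} ≈ (2·10^{-19})^{l} > 0` (`t_c = 0.2181 > 0`, `tanh_criticalBeta_pos`).
(With GKS, `Z_∅(G)/Z_∅(G-e) = 1 + t⟨σ_uσ_v⟩_{G-e} ≤ 1+t`, the constant improves to `(t/(1+t))^{8l}
t^{4l}`; irrelevant for `∃ c(l)`.)  MORAL: the crux is exactly the `l`-UNIFORMITY of this constant;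
exponentially small constants are free, and the `N → ∞` limit is harmless (no strand escapes to the
boundary at fixed `l` with probability `1`). -/
def IndependentStrandsJoinPerScale : Prop :=
  let tetra : Fin 4 → Literature.Probability.LatticeModels.Site 3 := ![![-1, -1, -1], ![1, 1, -1], ![1, -1, 1], ![-1, 1, 1]]; ∀ l : ℕ, 1 ≤ l → ∃ c : ℝ, 0 < c ∧ ∃ N₀ : ℕ, ∀ N : ℕ, N₀ ≤ N → ∀ a : Fin 4 → ↥(Literature.Probability.LatticeModels.box 3 N), (∀ i, ((a i : Literature.Probability.LatticeModels.Site 3)) = (l : ℤ) • tetra i) → (let G := ((Literature.Probability.LatticeModels.zdGraph 3).comap (Subtype.val : ↥(Literature.Probability.LatticeModels.box 3 N) → Literature.Probability.LatticeModels.Site 3)); let t : ℝ := Real.tanh (Literature.Probability.LatticeModels.criticalBeta 3); c * Literature.Probability.LatticeModels.loopO1PartitionFunction G t {a 0, a 1} * Literature.Probability.LatticeModels.loopO1PartitionFunction G t {a 2, a 3} ≤ ∑ F₁ ∈ Literature.Probability.LatticeModels.tJoins G Set.univ {a 0, a 1}, ∑ F₂ ∈ Literature.Probability.LatticeModels.tJoins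 G Set.univ {a 2, a 3}, if (SimpleGraph.fromEdgeSet ((↑F₁ : Set (Sym2 ↥(Literature.Probability.LatticeModels.box 3 N))) ∪ ↑F₂)).Reachable (a 0) (a 2) then t ^ (F₁.card + F₂.card) else 0)

/-- The inner double sum of the crux is nonnegative (`t_c = tanh β_c ≥ 0`). [folklore] -/
theorem innerSum_nonneg {N : ℕ} (a : Fin 4 → ↥(box 3 N)) :
    0 ≤ ∑ F₁ ∈ tJoins ((zdGraph 3).comap (Subtype.val : ↥(box 3 N) → Site 3)) Set.univ {a 0, a 1},
      ∑ F₂ ∈ tJoins ((zdGraph 3).comap (Subtype.val : ↥(box 3 N) → Site 3)) Set.univ {a 2, a 3},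
        if (SimpleGraph.fromEdgeSet ((↑F₁ : Set (Sym2 ↥(box 3 N))) ∪ ↑F₂)).Reachable (a 0) (a 2)
          then Real.tanh (criticalBeta 3) ^ (F₁.card + F₂.card) else (0 : ℝ) :=
  jointSum_nonneg _ tanh_criticalBeta_nonneg a

/-- **`0 < c` carries all the content**: with it dropped the crux holds with `c = 0`. [folklore] -/
theorem independentStrandsJoinWithoutHc_holds : IndependentStrandsJoinWithoutHc := by
  refine ⟨0, fun l _ => ⟨0, fun N _ a _ => ?_⟩⟩
  simp only [zero_mul]
  exact innerSum_nonneg a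

/-- At `l = 0` the inner inequality of the crux is `0 ≤ 0`-true for EVERY `c`: the sources coincide,
`{a₀, a₁} = {a₀}` and `Z({a₀}) = 0` (`loopO1PartitionFunction_singleton`). [folklore] -/
theorem inner_holds_at_l_zero (c : ℝ) {N : ℕ} (a : Fin 4 → ↥(box 3 N))
    (ha : ∀ i, ((a i : Site 3)) = ((0 : ℕ) : ℤ) • tetra i) :
    c * loopO1PartitionFunction ((zdGraph 3).comap (Subtype.val : ↥(box 3 N) → Site 3))
        (Real.tanh (criticalBeta 3)) {a 0, a 1} *
      loopO1PartitionFunction ((zdGraph 3).comap (Subtype.val : ↥(box 3 N) → Site 3))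
        (Real.tanh (criticalBeta 3)) {a 2, a 3} ≤
    ∑ F₁ ∈ tJoins ((zdGraph 3).comap (Subtype.val : ↥(box 3 N) → Site 3)) Set.univ {a 0, a 1},
      ∑ F₂ ∈ tJoins ((zdGraph 3).comap (Subtype.val : ↥(box 3 N) → Site 3)) Set.univ {a 2, a 3},
        if (SimpleGraph.fromEdgeSet ((↑F₁ : Set (Sym2 ↥(box 3 N))) ∪ ↑F₂)).Reachable (a 0) (a 2)
          then Real.tanh (criticalBeta 3) ^ (F₁.card + F₂.card) else (0 : ℝ) := by
  have h01 : a 0 = a 1 := Subtype.ext (by rw [ha 0, ha 1]; simp)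
  have hpair : ({a 0, a 1} : Finset ↥(box 3 N)) = {a 0} := by rw [← h01]; simp
  rw [hpair, loopO1PartitionFunction_singleton, mul_zero, zero_mul]
  rw [← hpair]
  exact innerSum_nonneg a

/-- **`1 ≤ l` is NOT load-bearing**: the crux with and without it are equivalent (the `l = 0` instance
is degenerate-true, `inner_holds_at_l_zero`).  For provers: the hypothesis enters only through the
injectivity of `a` (`tetra_injective`), which makes the statement non-empty, never through an
estimate. [folklore] -/
theorem independentStrandsJoinWithoutHl_iff :
    IndependentStrandsJoinWithoutHl ↔ IndependentStrandsJoin := by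
  constructor
  · rintro ⟨c, hc, h⟩
    exact ⟨c, hc, fun l _ => h l⟩
  · rintro ⟨c, hc, h⟩
    refine ⟨c, hc, fun l => ?_⟩
    rcases Nat.eq_zero_or_pos l with rfl | hl
    · exact ⟨0, fun N _ a ha => inner_holds_at_l_zero c a ha⟩
    · exact h l hl

/-- The crux trivially implies its per-scale form; the converse implication is exactly the open
content (uniformity of the constant in `l`). [folklore] -/
theorem perScale_of_independentStrandsJoin : IndependentStrandsJoin → IndependentStrandsJoinPerScale := by
  rintro ⟨c, hc, h⟩ l hl
  exact ⟨c, hc, h l hl⟩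

/-! ## § A″. The per-scale toolkit: XOR transport, forcing, edge deletion (positive helpers, proved)

The three general finite-graph facts behind steps (1)–(3) of the per-scale bound in the docstring of
`IndependentStrandsJoinPerScale` (for `0 ≤ t ≤ 1`; `Z_A(ω) := Σ_{F ∈ 𝒯_A(ω)} t^{|F|}`):
`xor_transport_le` (`t^{|P|} Z_A(ω) ≤ Z_{A∆B}(ω)` for `P ∈ 𝒯_B(ω)`), `forcing_decomposition`
(`Σ_{F ∈ 𝒯_A, F ⊇ D} t^{|F|} = t^{|D|} Z_{A∆B}((↑D)ᶜ)` for `D ∈ 𝒯_B`), `edge_deletion_le`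
(`t^{|P|} Z_A(ω) ≤ (t^{|P|} + t) Z_A(ω ∖ {e})` for a detour `P ∈ 𝒯_{uv}(ω ∖ {e})` of the edge `e = uv`).
What is NOT here: the explicit lattice paths `γ`, `Q` and the plaquette detours inside `Λ_N` (routine
but long), i.e. the per-scale statement itself — a positive statement, left to provers (also attached
stand-alone as evidence `PathForcing.lean`).
-/

section PerScaleToolkit

variable {V : Type*} [Fintype V] [DecidableEq V] (G : SimpleGraph V) [DecidableRel G.Adj]

/-- `|F ∆ P| ≤ |F| + |P|`. [folklore] -/
theorem card_symmDiff_le (F P : Finset (Sym2 V)) : #(symmDiff F P) ≤ #F + #P :=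
  (Finset.card_le_card (symmDiff_le_sup (a := F) (b := P))).trans (Finset.card_union_le F P)

/-- **XOR transport inequality.**  For `0 ≤ t ≤ 1` and a `T`-join `P` of `B` inside `ω`,
`t^{|P|} · Σ_{F ∈ 𝒯_A(ω)} t^{|F|} ≤ Σ_{F ∈ 𝒯_{A ∆ B}(ω)} t^{|F|}`: the involution `F ↦ F ∆ P` maps
`𝒯_A(ω)` injectively into `𝒯_{A∆B}(ω)` (`symmDiff_mem_tJoins`) and `t^{|F|+|P|} ≤ t^{|F ∆ P|}`. [folklore] -/
theorem xor_transport_le {t : ℝ} (ht0 : 0 ≤ t) (ht1 : t ≤ 1) {ω : Set (Sym2 V)} {A B : Finset V}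
    {P : Finset (Sym2 V)} (hP : P ∈ tJoins G ω B) :
    t ^ #P * ∑ F ∈ tJoins G ω A, t ^ #F ≤ ∑ F ∈ tJoins G ω (symmDiff A B), t ^ #F := by
  calc t ^ #P * ∑ F ∈ tJoins G ω A, t ^ #F
      = ∑ F ∈ tJoins G ω A, t ^ (#F + #P) := by
        rw [Finset.mul_sum]
        refine Finset.sum_congr rfl fun F _ => ?_
        rw [pow_add, mul_comm]
    _ ≤ ∑ F ∈ tJoins G ω A, t ^ #(symmDiff F P) :=
        Finset.sum_le_sum fun F _ => pow_le_pow_of_le_one ht0 ht1 (card_symmDiff_le F P)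
    _ = ∑ F' ∈ (tJoins G ω A).image (fun F => symmDiff F P), t ^ #F' := by
        rw [Finset.sum_image]
        intro F₁ _ F₂ _ h
        simpa using congrArg (fun S => symmDiff S P) h
    _ ≤ ∑ F ∈ tJoins G ω (symmDiff A B), t ^ #F := by
        refine Finset.sum_le_sum_of_subset_of_nonneg ?_ fun F _ _ => pow_nonneg ht0 _
        intro F' hF'
        obtain ⟨F, hF, rfl⟩ := Finset.mem_image.1 hF'
        exact symmDiff_mem_tJoins G hF hP

/-- Changing the ambient edge set `ω` of `tJoins`: only `↑F ⊆ ω` matters. [folklore] -/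
theorem mem_tJoins_of_subset {ω ω' : Set (Sym2 V)} {A : Finset V} {F : Finset (Sym2 V)}
    (hF : F ∈ tJoins G ω A) (hω : (↑F : Set (Sym2 V)) ⊆ ω') : F ∈ tJoins G ω' A := by
  rw [mem_tJoins] at hF ⊢
  exact ⟨hF.1, hω, hF.2.2⟩

/-- **Forcing decomposition.**  For a `T`-join `D` of `B` (inside `E(G)`), the `T`-joins of `A`
CONTAINING `D` are exactly the sets `E ∪ D`, `E` a `T`-join of `A ∆ B` avoiding the edges of `D`, and
`|E ∪ D| = |E| + |D|`; hence `Σ_{F ∈ 𝒯_A, D ⊆ F} t^{|F|} = t^{|D|} · Σ_{E ∈ 𝒯_{A∆B}((↑D)ᶜ)} t^{|E|}`.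
(With `A = B = {x,y}` and `D = γ` a fixed `x–y` path: forcing the path `γ` into the strand costs the
factor `t^{|γ|}` against the EVEN subgraphs avoiding `γ` — step (1) of the per-scale bound.) [folklore] -/
theorem forcing_decomposition (t : ℝ) {A B : Finset V} {D : Finset (Sym2 V)}
    (hD : D ∈ tJoins G Set.univ B) :
    ∑ F ∈ (tJoins G Set.univ A).filter (fun F => D ⊆ F), t ^ #F =
      t ^ #D * ∑ E ∈ tJoins G ((↑D : Set (Sym2 V))ᶜ) (symmDiff A B), t ^ #E := by
  -- the map `E ↦ E ∪ D` and its image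
  have himage : (tJoins G ((↑D : Set (Sym2 V))ᶜ) (symmDiff A B)).image (fun E => E ∪ D) =
      (tJoins G Set.univ A).filter (fun F => D ⊆ F) := by
    ext F
    simp only [Finset.mem_image, Finset.mem_filter]
    constructor
    · rintro ⟨E, hE, rfl⟩
      have hEω := ((mem_tJoins G).1 hE).2.1
      have hdisj : Disjoint E D := by
        rw [Finset.disjoint_left]
        intro e heE heD
        exact hEω (Finset.mem_coe.2 heE) (Finset.mem_coe.2 heD)
      have hE' : E ∈ tJoins G Set.univ (symmDiff A B) := mem_tJoins_of_subset G hE (Set.subset_univ _)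
      have h := symmDiff_mem_tJoins G hE' hD
      rw [symmDiff_symmDiff_cancel_right, hdisj.symmDiff_eq_sup] at h
      exact ⟨h, Finset.subset_union_right⟩
    · rintro ⟨hF, hDF⟩
      refine ⟨F \ D, ?_, Finset.sdiff_union_of_subset hDF⟩
      have h := symmDiff_mem_tJoins G hF hD
      rw [symmDiff_of_ge hDF] at h
      refine mem_tJoins_of_subset G h ?_
      intro e he
      rw [Finset.mem_coe, Finset.mem_sdiff] at he
      exact fun heD => he.2 (Finset.mem_coe.1 heD)
  have hinj : Set.InjOn (fun E : Finset (Sym2 V) => E ∪ D)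
      ↑(tJoins G ((↑D : Set (Sym2 V))ᶜ) (symmDiff A B)) := by
    intro E₁ hE₁ E₂ hE₂ h
    have hω₁ := ((mem_tJoins G).1 (Finset.mem_coe.1 hE₁)).2.1
    have hω₂ := ((mem_tJoins G).1 (Finset.mem_coe.1 hE₂)).2.1
    have hd₁ : Disjoint E₁ D := Finset.disjoint_left.2 fun e he heD =>
      hω₁ (Finset.mem_coe.2 he) (Finset.mem_coe.2 heD)
    have hd₂ : Disjoint E₂ D := Finset.disjoint_left.2 fun e he heD =>
      hω₂ (Finset.mem_coe.2 he) (Finset.mem_coe.2 heD)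
    have := congrArg (fun S => S \ D) h
    simpa [Finset.union_sdiff_cancel_right, hd₁, hd₂] using this
  rw [← himage, Finset.sum_image hinj, Finset.mul_sum]
  refine Finset.sum_congr rfl fun E hE => ?_
  have hEω := ((mem_tJoins G).1 hE).2.1
  have hdisj : Disjoint E D := Finset.disjoint_left.2 fun e he heD =>
    hEω (Finset.mem_coe.2 he) (Finset.mem_coe.2 heD)
  rw [Finset.card_union_of_disjoint hdisj, pow_add, mul_comm]

/-- A single edge `e = uv` of `G` inside `ω` is a `T`-join of `{u, v}`. [folklore] -/
theorem singleton_mem_tJoins {ω : Set (Sym2 V)} {u v : V} (huv : G.Adj u v) (hω : s(u, v) ∈ ω) :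
    ({s(u, v)} : Finset (Sym2 V)) ∈ tJoins G ω {u, v} := by
  rw [mem_tJoins]
  refine ⟨by simpa using huv, by simpa using hω, fun w => ?_⟩
  by_cases hw : w ∈ s(u, v)
  · rw [Finset.filter_singleton, if_pos hw, Finset.card_singleton]
    have : w = u ∨ w = v := Sym2.mem_iff.1 hw
    simp [this]
  · rw [Finset.filter_singleton, if_neg hw, Finset.card_empty]
    have hu : w ≠ u := fun h => hw (h ▸ Sym2.mem_mk_left u v)
    have hv : w ≠ v := fun h => hw (h ▸ Sym2.mem_mk_right u v)
    simp [hu, hv]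

/-- **Edge deletion with a detour.**  For `0 ≤ t ≤ 1`, an edge `e = uv` of `G` and a `u–v` detour
`P ∈ 𝒯_{uv}(ω ∖ {e})`:  `t^{|P|} · Z_A(ω) ≤ (t^{|P|} + t) · Z_A(ω ∖ {e})`, where
`Z_A(ω) = Σ_{F ∈ 𝒯_A(ω)} t^{|F|}`.  (Split `𝒯_A(ω)` by `e ∈ F`; the `T`-joins through `e` are, after
erasing `e`, `T`-joins of `A ∆ {u,v}` in `ω ∖ {e}`, transported back to `𝒯_A(ω ∖ {e})` by
`xor_transport_le` with `P`.)  With a 3-edge plaquette detour this is the factor `1 + t^{-2}` of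
step (2) of the per-scale bound. [folklore] -/
theorem edge_deletion_le {t : ℝ} (ht0 : 0 ≤ t) (ht1 : t ≤ 1) {ω : Set (Sym2 V)} (A : Finset V)
    {u v : V} (huv : G.Adj u v) {P : Finset (Sym2 V)}
    (hP : P ∈ tJoins G (ω \ {s(u, v)}) {u, v}) :
    t ^ #P * ∑ F ∈ tJoins G ω A, t ^ #F ≤
      (t ^ #P + t) * ∑ F ∈ tJoins G (ω \ {s(u, v)}) A, t ^ #F := by
  set e : Sym2 V := s(u, v) with he
  have hnn : ∀ F : Finset (Sym2 V), 0 ≤ t ^ #F := fun F => pow_nonneg ht0 _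
  -- split by `e ∈ F`
  have hsplit : ∑ F ∈ tJoins G ω A, t ^ #F =
      ∑ F ∈ (tJoins G ω A).filter (fun F => e ∉ F), t ^ #F +
        ∑ F ∈ (tJoins G ω A).filter (fun F => e ∈ F), t ^ #F := by
    rw [← Finset.sum_filter_add_sum_filter_not (tJoins G ω A) (fun F => e ∈ F), add_comm]
  -- the `e ∉ F` part lives in `𝒯_A(ω ∖ {e})`
  have h1 : ∑ F ∈ (tJoins G ω A).filter (fun F => e ∉ F), t ^ #F ≤
      ∑ F ∈ tJoins G (ω \ {e}) A, t ^ #F := by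
    refine Finset.sum_le_sum_of_subset_of_nonneg (fun F hF => ?_) fun F _ _ => hnn F
    rw [Finset.mem_filter] at hF
    refine mem_tJoins_of_subset G hF.1 fun x hx => ⟨((mem_tJoins G).1 hF.1).2.1 hx, ?_⟩
    rintro rfl
    exact hF.2 (Finset.mem_coe.1 hx)
  -- the `e ∈ F` part, after erasing `e`, lives in `𝒯_{A ∆ {u,v}}(ω ∖ {e})`
  have h2 : ∑ F ∈ (tJoins G ω A).filter (fun F => e ∈ F), t ^ #F ≤
      t * ∑ F ∈ tJoins G (ω \ {e}) (symmDiff A {u, v}), t ^ #F := by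
    have himg : ∀ F ∈ (tJoins G ω A).filter (fun F => e ∈ F),
        F.erase e ∈ tJoins G (ω \ {e}) (symmDiff A {u, v}) := by
      intro F hF
      rw [Finset.mem_filter] at hF
      have heω : e ∈ ω := ((mem_tJoins G).1 hF.1).2.1 (Finset.mem_coe.2 hF.2)
      have hsing := singleton_mem_tJoins G (ω := ω) huv heω
      have h := symmDiff_mem_tJoins G hF.1 hsing
      rw [symmDiff_of_ge (Finset.singleton_subset_iff.2 hF.2), Finset.sdiff_singleton_eq_erase] at h
      refine mem_tJoins_of_subset G h fun x hx => ⟨((mem_tJoins G).1 h).2.1 hx, ?_⟩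
      have hx' := Finset.mem_coe.1 hx
      rw [Finset.mem_erase] at hx'
      exact fun hxe => hx'.1 hxe
    calc ∑ F ∈ (tJoins G ω A).filter (fun F => e ∈ F), t ^ #F
        = ∑ F ∈ (tJoins G ω A).filter (fun F => e ∈ F), t * t ^ #(F.erase e) := by
          refine Finset.sum_congr rfl fun F hF => ?_
          rw [Finset.mem_filter] at hF
          rw [← pow_succ', Finset.card_erase_add_one hF.2]
      _ = t * ∑ F ∈ (tJoins G ω A).filter (fun F => e ∈ F), t ^ #(F.erase e) := by
          rw [Finset.mul_sum]
      _ = t * ∑ F' ∈ ((tJoins G ω A).filter (fun F => e ∈ F)).image (fun F => F.erase e), t ^ #F' := by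
          rw [Finset.sum_image]
          intro F₁ h₁ F₂ h₂ h
          rw [Finset.mem_coe, Finset.mem_filter] at h₁ h₂
          rw [← Finset.insert_erase h₁.2, ← Finset.insert_erase h₂.2]
          exact congrArg (insert e) h
      _ ≤ t * ∑ F ∈ tJoins G (ω \ {e}) (symmDiff A {u, v}), t ^ #F := by
          refine mul_le_mul_of_nonneg_left ?_ ht0
          refine Finset.sum_le_sum_of_subset_of_nonneg (fun F' hF' => ?_) fun F _ _ => hnn F
          obtain ⟨F, hF, rfl⟩ := Finset.mem_image.1 hF'
          exact himg F hF
  -- transport the second part back with the detour `P`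
  have h3 : t ^ #P * ∑ F ∈ tJoins G (ω \ {e}) (symmDiff A {u, v}), t ^ #F ≤
      ∑ F ∈ tJoins G (ω \ {e}) A, t ^ #F := by
    have h := xor_transport_le G ht0 ht1 (A := symmDiff A {u, v}) hP
    rwa [symmDiff_symmDiff_cancel_right] at h
  have hPnn : 0 ≤ t ^ #P := pow_nonneg ht0 _
  calc t ^ #P * ∑ F ∈ tJoins G ω A, t ^ #F
      = t ^ #P * ∑ F ∈ (tJoins G ω A).filter (fun F => e ∉ F), t ^ #F +
          t ^ #P * ∑ F ∈ (tJoins G ω A).filter (fun F => e ∈ F), t ^ #F := by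
        rw [hsplit, mul_add]
    _ ≤ t ^ #P * ∑ F ∈ tJoins G (ω \ {e}) A, t ^ #F +
          t ^ #P * (t * ∑ F ∈ tJoins G (ω \ {e}) (symmDiff A {u, v}), t ^ #F) := by
        gcongr
    _ = t ^ #P * ∑ F ∈ tJoins G (ω \ {e}) A, t ^ #F +
          t * (t ^ #P * ∑ F ∈ tJoins G (ω \ {e}) (symmDiff A {u, v}), t ^ #F) := by ring
    _ ≤ t ^ #P * ∑ F ∈ tJoins G (ω \ {e}) A, t ^ #F +
          t * ∑ F ∈ tJoins G (ω \ {e}) A, t ^ #F := by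
        gcongr
    _ = (t ^ #P + t) * ∑ F ∈ tJoins G (ω \ {e}) A, t ^ #F := by ring

end PerScaleToolkit

/-! ## § B. Targets — the line `Sketch`: stubs all true; `stub_tetraU4Lattice ⟺ crux`

Stub verdicts (statements: `ledger workitem stubs stmt-CriticalPhenomena-14625`):
* `stub_pairSplit` (TRUE): `F ↦ (K_{a₀}(F), F ∖ K)` is a bijection from `{F ∈ 𝒯(a₀a₁) : a₂, a₃ ∉ V(K)}`
  onto `{source clusters K} × 𝓔_∅(G - V(K))`, and `⟨σ_{a₂}σ_{a₃}⟩^free_{G-V(K)} = Z_{a₂a₃}(G-V(K))/Z_∅(G-V(K))`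
  (`isingCorr_free_eq_hteSum_div` on the induced subgraph); regrouping, `Σ_F t^{|F|}⟨σσ⟩_{G-V(K_F)} =
  Σ_K t^{|K|} Z_{a₂a₃}(G - V(K)) = Σ_{D ∈ 𝒯(A), a₀ ≁ a₂, a₀ ≁ a₃} t^{|D|}` (`D = K ⊔ F'`; conversely the
  `a₀`-component of such a `D` contains `a₁` by the handshake lemma and avoids `a₂, a₃`).
* `stub_separation` (TRUE): the avoidance sum `Z₀₁Z₂₃ - jointSum_K = Σ_{F₁} t^{|F₁|} Σ_{F₂ : V(K₂) ∩ V(K₁) = ∅}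
  t^{|F₂|}`; if `a₂ ∈ V(K₁)` or `a₃ ∈ V(K₁)` the inner sum is `0` (each `T`-join of a pair joins its pair,
  `reachable_of_mem_tJoins_pair`); otherwise DepletionBound with `S = V(K₁)` bounds it by
  `Z₂₃·⟨σσ⟩_{G-V(K₁)}/⟨σσ⟩_G`, and `stub_pairSplit` turns the `F₁`-sum into `Z_∅·Σ_{H(01|23)} t^{|D|}`
  (`Z₂₃ = ⟨σσ⟩_G Z_∅`); the cases `⟨σ₂σ₃⟩_G = 0` / `t = 0` have both sides `0 ≤ RHS`.
* `stub_symmetry` (TRUE, `t ≥ 0`): the automorphism `φ` (`a₁ ↔ a₂`, fixing `a₀,a₃`) maps the class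
  `H(01|23) = {D ∈ 𝒯(A) : a₀ ≁ a₂, a₀ ≁ a₃}` bijectively onto `H(02|13)`, `ψ` onto `H(03|12)`; the three
  classes are pairwise disjoint subsets of `𝒯(A)` with equal `t`-mass, so `3·Σ_{H(01|23)} ≤ Z(A)`; and
  `Z_{φS} = Z_S` gives the two product identities.
* `stub_boxSymmetry` (TRUE): the coordinate permutations `(x,y,z) ↦ (x,z,y)` and `(x,y,z) ↦ (z,y,x)` preserve
  `Λ_N` and adjacency, fix `a₀ = (-l,-l,-l)`, and act on `a₁ = (l,l,-l)`, `a₂ = (l,-l,l)`, `a₃ = (-l,l,l)` as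
  required (`a₁ ↔ a₂` fixing `a₃`; `a₁ ↔ a₃` fixing `a₂`).
* `stub_depletionBound` = route support `DepletionBound` (AF86 Claim 4.15; TRUE); `stub_transfer`: algebra
  (`U₄ = Z(A)/Z_∅ - 3Z₀₁Z₂₃/Z_∅²` by the product identities; `U₄ ≤ -cG₀₁G₂₃` ⇒ `Z(A)Z_∅ ≤ (3-c)Z₀₁Z₂₃` ⇒
  `jointSum ≥ jointSum_K ≥ Z₀₁Z₂₃ - Z(A)Z_∅/3 ≥ (c/3)Z₀₁Z₂₃`).
So the line proves `crux ⟸ stub_tetraU4Lattice` with `c_crux = c/3`; conversely (below, kernel-checked)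
`StrandsJoinBound → crux → stub_tetraU4Lattice` with constant `2c`.  The stub set is TIGHT and sound, and its one
open member is the crux itself in `U₄`-dress.
-/

section Targets

variable {V : Type*} [Fintype V] [DecidableEq V] (G : SimpleGraph V) [DecidableRel G.Adj]

/-- The tree's two high-temperature sums agree on the whole graph:
`hteSum G univ t A = loopO1PartitionFunction G t A` (bridges `isingCorr_free_eq_hteSum_div` to the
route's `loopO1PartitionFunction`). [folklore] -/
theorem hteSum_univ_eq_loopO1PartitionFunction (t : ℝ) (A : Finset V) :
    hteSum G Finset.univ t A = loopO1PartitionFunction G t A := by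
  rw [loopO1PartitionFunction_eq_sum_tJoins]
  unfold hteSum
  refine Finset.sum_congr ?_ fun _ _ => rfl
  ext F
  have hE : edgesIn G Finset.univ = G.edgeFinset := by
    ext e
    rw [mem_edgesIn_iff, SimpleGraph.mem_edgeFinset]
    simp
  simp only [Finset.mem_filter, Finset.mem_powerset, mem_tJoins, Set.subset_univ, true_and, hE]
  refine and_congr_right fun _ => ?_
  simp only [oddVerts, Finset.ext_iff, Finset.mem_filter, Finset.mem_univ, true_and]

/-- **`StrandsJoinBound → crux → stub_tetraU4Lattice`** (the converse of the line `Sketch`, constant `2c`):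
the crux and the route support `StrandsJoinBound` (`U₄·Z_∅² ≤ -2·jointSum`, Aizenman's identity + law of the
odd part) give the line's only content-bearing stub — the finite-box tetrahedral bound
`U₄^free_{Λ_N}(A_l) ≤ -(2c)·⟨σ_{a₀}σ_{a₁}⟩⟨σ_{a₂}σ_{a₃}⟩` (statement of `stub_tetraU4Lattice` verbatim), via
`⟨σ_xσ_y⟩^free = Z_{xy}/Z_∅` (`isingCorr_free_eq_hteSum_div`, `hteSum_univ_eq_loopO1PartitionFunction`).
Together with the line (`stub_transfer`: tetraU4Lattice ⇒ crux with `c/3`) this makes the stub and the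
crux EQUIVALENT modulo provable finite identities. [folklore] -/
theorem tetraU4Lattice_of_crux (hSJB : StrandsJoinBound) (hK : IndependentStrandsJoin) :
    ∃ c : ℝ, 0 < c ∧ ∀ l : ℕ, 1 ≤ l → ∃ N₀ : ℕ, ∀ N : ℕ, N₀ ≤ N → ∀ a : Fin 4 → ↥(box 3 N), (∀ i, ((a i : Site 3)) = (l : ℤ) • (![![-1, -1, -1], ![1, 1, -1], ![1, -1, 1], ![-1, 1, 1]] : Fin 4 → Site 3) i) → connectedFour (isingMeasure ((zdGraph 3).comap (Subtype.val : ↥(box 3 N) → Site 3)) Finset.univ (criticalBeta 3) 0 .free) spinAt a ≤ -(c * isingCorr ((zdGraph 3).comap (Subtype.val : ↥(box 3 N) → Site 3)) Finset.univ (criticalBeta 3) 0 .free {a 0, a 1} * isingCorr ((zdGraph 3).comap (Subtype.val : ↥(box 3 N) → Site 3)) Finset.univ (criticalBeta 3) 0 .free {a 2, a 3}) := by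
  obtain ⟨c, hc, h⟩ := hK
  refine ⟨2 * c, by positivity, fun l hl => ?_⟩
  obtain ⟨N₀, hN⟩ := h l hl
  refine ⟨N₀, fun N hNN a ha => ?_⟩
  have hcrux := hN N hNN a ha
  simp only at hcrux
  set G := (zdGraph 3).comap (Subtype.val : ↥(box 3 N) → Site 3) with hG
  have hinj : Function.Injective a := tetra_injective hl a (fun i => by rw [ha i]; rfl)
  have hS := hSJB (↥(box 3 N)) G (criticalBeta 3) (criticalBeta_nonneg 3) a hinj
  simp only at hS
  have hZ0 : 0 < loopO1PartitionFunction G (Real.tanh (criticalBeta 3)) ∅ :=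
    loopO1PartitionFunction_empty_pos G tanh_criticalBeta_nonneg
  have h01 : isingCorr G Finset.univ (criticalBeta 3) 0 .free {a 0, a 1} =
      loopO1PartitionFunction G (Real.tanh (criticalBeta 3)) {a 0, a 1} /
        loopO1PartitionFunction G (Real.tanh (criticalBeta 3)) ∅ := by
    rw [isingCorr_free_eq_hteSum_div G Finset.univ (criticalBeta 3) (Finset.subset_univ _),
      hteSum_univ_eq_loopO1PartitionFunction, hteSum_univ_eq_loopO1PartitionFunction]
  have h23 : isingCorr G Finset.univ (criticalBeta 3) 0 .free {a 2, a 3} =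
      loopO1PartitionFunction G (Real.tanh (criticalBeta 3)) {a 2, a 3} /
        loopO1PartitionFunction G (Real.tanh (criticalBeta 3)) ∅ := by
    rw [isingCorr_free_eq_hteSum_div G Finset.univ (criticalBeta 3) (Finset.subset_univ _),
      hteSum_univ_eq_loopO1PartitionFunction, hteSum_univ_eq_loopO1PartitionFunction]
  rw [h01, h23]
  set Z0 := loopO1PartitionFunction G (Real.tanh (criticalBeta 3)) ∅
  set Z01 := loopO1PartitionFunction G (Real.tanh (criticalBeta 3)) {a 0, a 1}
  set Z23 := loopO1PartitionFunction G (Real.tanh (criticalBeta 3)) {a 2, a 3}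
  set U4 := connectedFour (isingMeasure G Finset.univ (criticalBeta 3) 0 .free) spinAt a
  have hmain : U4 * Z0 ^ 2 ≤ -(2 * c * Z01 * Z23) := hS.trans (by nlinarith [hcrux])
  have : -(2 * c * (Z01 / Z0) * (Z23 / Z0)) = -(2 * c * Z01 * Z23) / Z0 ^ 2 := by
    field_simp
  rw [this, le_div_iff₀ (by positivity)]
  exact hmain

end Targets

/-! ## § A′. A natural strengthening refuted: no GRAPH-UNIFORM constant (the path world)

The supports of the route (`StrandsJoinBound`, `DepletionBound`) are graph-uniform identities, and the
crux's conclusion makes sense on every finite graph with four distinct marked vertices.  The graph-uniform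
strengthening — ONE `c > 0` with `c·Z(a₀a₁)·Z(a₂a₃) ≤ jointSum` on EVERY finite graph — is FALSE already
on the CONNECTED path `0 – 1 – 2 – 3` with `(a₀,a₁,a₂,a₃) = (0,1,2,3)`: parity at the leaf `3` and then at
`2` expels the middle edge `12` from every `T`-join of `{0,1}` (and symmetrically from every `T`-join of
`{2,3}`), so `F₁ ∪ F₂ ⊆ {01, 23}` never joins `0` to `2`: `jointSum = 0 < c·t·t ≤ c·Z·Z`.  (On trees the
`T`-join of a pair is unique — the path — so `jointSum ∈ {0, Z·Z}`; on the cycles `C_n` with the two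
pairs adjacent and antipodal `jointSum/(Z·Z) = 1 - t²/(t + t^{n-1})² → 0`: no uniform constant on
2-connected graphs either.)  MORAL for provers: like BLOB's H-world, any proof must use the geometry of
`Λ_N ⊂ ℤ³` proper — here, that the two source pairs are INTERLEAVED at one scale (opposite edges of a
regular tetrahedron) in a graph where strands are fat (`2·D_HT > 3`); in the path world the pairs are
separated by a cut edge that parity forbids to both strands.
-/

section PathWorld

/-- Edge set of the path `0 – 1 – 2 – 3` (local notation; theorem-only file). -/
local notation "pEdges" => ({s(0,1), s(1,2), s(2,3)} : Finset (Sym2 (Fin 4)))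

/-- The path `0 – 1 – 2 – 3` as a simple graph on `Fin 4`. -/
local notation "pGraph" => (SimpleGraph.fromEdgeSet
  ((({s(0,1), s(1,2), s(2,3)} : Finset (Sym2 (Fin 4))) : Set (Sym2 (Fin 4)))))

/-- The path has no loops. [folklore] -/
theorem pEdges_not_isDiag : ∀ e ∈ pEdges, ¬ e.IsDiag := by decide

/-- The edge finset of the path graph is `pEdges` (for every `Fintype` instance on its edge set). [folklore] -/
theorem pGraph_edgeFinset {inst : Fintype (pGraph).edgeSet} :
    @SimpleGraph.edgeFinset (Fin 4) pGraph inst = pEdges := by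
  ext e
  rw [SimpleGraph.mem_edgeFinset, SimpleGraph.edgeSet_fromEdgeSet]
  simp only [Set.mem_sdiff, Finset.mem_coe]
  exact ⟨fun h => h.1, fun h => ⟨h, pEdges_not_isDiag e h⟩⟩

set_option maxRecDepth 20000 in
/-- Parity at the leaf `3` and then at `2` expels the middle edge `12` from every `T`-join of `{0,1}`
(checked by `decide` over the `8` subsets of `pEdges`). [folklore] -/
theorem no12_of_tJoin01 : ∀ F ∈ (pEdges).powerset,
    (∀ v : Fin 4, Odd (F.filter (fun e => v ∈ e)).card ↔ v ∈ ({0, 1} : Finset (Fin 4))) → s(1,2) ∉ F := by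
  decide

set_option maxRecDepth 20000 in
/-- Symmetrically, parity at `0` and then at `1` expels `12` from every `T`-join of `{2,3}`. [folklore] -/
theorem no12_of_tJoin23 : ∀ F ∈ (pEdges).powerset,
    (∀ v : Fin 4, Odd (F.filter (fun e => v ∈ e)).card ↔ v ∈ ({2, 3} : Finset (Fin 4))) → s(1,2) ∉ F := by
  decide

/-- `{01}` has source set `{0,1}`. [folklore] -/
theorem single01_parity : ∀ v : Fin 4,
    Odd (({s(0,1)} : Finset (Sym2 (Fin 4))).filter (fun e => v ∈ e)).card ↔ v ∈ ({0, 1} : Finset (Fin 4)) := by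
  decide

/-- `{23}` has source set `{2,3}`. [folklore] -/
theorem single23_parity : ∀ v : Fin 4,
    Odd (({s(2,3)} : Finset (Sym2 (Fin 4))).filter (fun e => v ∈ e)).card ↔ v ∈ ({2, 3} : Finset (Fin 4)) := by
  decide

/-- Walks stay inside a set closed under adjacency. [folklore] -/
theorem mem_of_reachable_of_closed {W : Type*} {H : SimpleGraph W} {S : Set W}
    (hS : ∀ u v, H.Adj u v → u ∈ S → v ∈ S) {u v : W} (h : H.Reachable u v) (hu : u ∈ S) : v ∈ S := by
  obtain ⟨p⟩ := h
  induction p with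
  | nil => exact hu
  | cons hadj _ ih => exact ih (hS _ _ hadj hu)

/-- Without the middle edge, `{0,1}` is closed in `F₁ ∪ F₂`, so `0` does not reach `2`. [folklore] -/
theorem p_not_reachable (F₁ F₂ : Finset (Sym2 (Fin 4))) (h₁ : F₁ ⊆ pEdges) (h₂ : F₂ ⊆ pEdges)
    (h12₁ : s(1,2) ∉ F₁) (h12₂ : s(1,2) ∉ F₂) :
    ¬ (SimpleGraph.fromEdgeSet ((↑F₁ : Set (Sym2 (Fin 4))) ∪ ↑F₂)).Reachable 0 2 := by
  intro h
  have hS : ∀ u v, (SimpleGraph.fromEdgeSet ((↑F₁ : Set (Sym2 (Fin 4))) ∪ ↑F₂)).Adj u v →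
      u ∈ (↑({0, 1} : Finset (Fin 4)) : Set (Fin 4)) → v ∈ (↑({0, 1} : Finset (Fin 4)) : Set (Fin 4)) := by
    intro u v huv hu
    rw [SimpleGraph.fromEdgeSet_adj] at huv
    obtain ⟨he, hne⟩ := huv
    have he' : s(u, v) ∈ pEdges ∧ s(u, v) ≠ s(1,2) := by
      rcases he with he | he
      · rw [Finset.mem_coe] at he
        exact ⟨h₁ he, fun h => h12₁ (h ▸ he)⟩
      · rw [Finset.mem_coe] at he
        exact ⟨h₂ he, fun h => h12₂ (h ▸ he)⟩
    rw [Finset.mem_coe] at hu ⊢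
    clear he hne h h₁ h₂ h12₁ h12₂
    revert u v
    decide
  have h2 := mem_of_reachable_of_closed hS h (by simp)
  rw [Finset.mem_coe] at h2
  exact absurd h2 (by decide)

/-- **No graph-uniform constant, at ANY edge weight `t > 0`.**  The crux's inequality with one
constant for all finite graphs and all injective source maps fails on the path `0 – 1 – 2 – 3`
(`jointSum = 0`, `Z(01), Z(23) ≥ t`). [folklore] -/
theorem not_graphUniformStrandsJoin_at {t : ℝ} (ht : 0 < t) :
    ¬ ∃ c : ℝ, 0 < c ∧ ∀ (V : Type) [Fintype V] [DecidableEq V] (G : SimpleGraph V) [DecidableRel G.Adj]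
      (a : Fin 4 → V), Function.Injective a →
      c * loopO1PartitionFunction G t {a 0, a 1} * loopO1PartitionFunction G t {a 2, a 3} ≤
        ∑ F₁ ∈ tJoins G Set.univ {a 0, a 1}, ∑ F₂ ∈ tJoins G Set.univ {a 2, a 3},
          if (SimpleGraph.fromEdgeSet ((↑F₁ : Set (Sym2 V)) ∪ ↑F₂)).Reachable (a 0) (a 2)
            then t ^ (#F₁ + #F₂) else 0 := by
  rintro ⟨c, hc, h⟩
  have key := h (Fin 4) pGraph (fun i => i) (fun _ _ h => h)
  have hrhs : (∑ F₁ ∈ tJoins pGraph Set.univ ({0, 1} : Finset (Fin 4)),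
      ∑ F₂ ∈ tJoins pGraph Set.univ ({2, 3} : Finset (Fin 4)),
        (if (SimpleGraph.fromEdgeSet ((↑F₁ : Set (Sym2 (Fin 4))) ∪ ↑F₂)).Reachable 0 2
          then t ^ (#F₁ + #F₂) else (0 : ℝ))) = 0 := by
    refine Finset.sum_eq_zero fun F₁ hF₁ => Finset.sum_eq_zero fun F₂ hF₂ => ?_
    obtain ⟨hF₁E, -, hpar₁⟩ := (mem_tJoins pGraph).1 hF₁
    obtain ⟨hF₂E, -, hpar₂⟩ := (mem_tJoins pGraph).1 hF₂
    rw [pGraph_edgeFinset] at hF₁E hF₂E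
    have h12₁ := no12_of_tJoin01 F₁ (Finset.mem_powerset.2 hF₁E) hpar₁
    have h12₂ := no12_of_tJoin23 F₂ (Finset.mem_powerset.2 hF₂E) hpar₂
    rw [if_neg (p_not_reachable F₁ F₂ hF₁E hF₂E h12₁ h12₂)]
  have hZ01 : t ≤ loopO1PartitionFunction pGraph t ({0, 1} : Finset (Fin 4)) := by
    rw [loopO1PartitionFunction_eq_sum_tJoins]
    have hmem : ({s(0,1)} : Finset (Sym2 (Fin 4))) ∈ tJoins pGraph Set.univ ({0, 1} : Finset (Fin 4)) := by
      rw [mem_tJoins, pGraph_edgeFinset]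
      exact ⟨by decide, Set.subset_univ _, single01_parity⟩
    have := Finset.single_le_sum (f := fun F : Finset (Sym2 (Fin 4)) => t ^ #F)
      (fun F _ => pow_nonneg ht.le _) hmem
    simpa using this
  have hZ23 : t ≤ loopO1PartitionFunction pGraph t ({2, 3} : Finset (Fin 4)) := by
    rw [loopO1PartitionFunction_eq_sum_tJoins]
    have hmem : ({s(2,3)} : Finset (Sym2 (Fin 4))) ∈ tJoins pGraph Set.univ ({2, 3} : Finset (Fin 4)) := by
      rw [mem_tJoins, pGraph_edgeFinset]
      exact ⟨by decide, Set.subset_univ _, single23_parity⟩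
    have := Finset.single_le_sum (f := fun F : Finset (Sym2 (Fin 4)) => t ^ #F)
      (fun F _ => pow_nonneg ht.le _) hmem
    simpa using this
  rw [hrhs] at key
  have hpos : 0 < c * loopO1PartitionFunction pGraph t ({0, 1} : Finset (Fin 4)) *
      loopO1PartitionFunction pGraph t ({2, 3} : Finset (Fin 4)) :=
    mul_pos (mul_pos hc (ht.trans_le hZ01)) (ht.trans_le hZ23)
  exact absurd key (not_le.mpr hpos)

end PathWorld

/-- `t_c = tanh β_c(3) > 0` (`β_c(3) > 0`, `criticalBeta_pos_holds`). [folklore] -/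
theorem tanh_criticalBeta_pos : 0 < Real.tanh (criticalBeta 3) := by
  rw [Real.tanh_eq_sinh_div_cosh]
  exact div_pos (Real.sinh_pos_iff.2 (criticalBeta_pos_holds (d := 3) (by norm_num))) (Real.cosh_pos _)

/-- **No graph-uniform `IndependentStrandsJoin` (natural strengthening refuted).**  At the critical
weight `t_c = tanh β_c(3)` of the crux there is NO constant `c > 0` such that
`c·Z(a₀a₁)·Z(a₂a₃) ≤ jointSum` on every finite graph with four distinct sources: the path world
(`not_graphUniformStrandsJoin_at` with `tanh_criticalBeta_pos`).  Any proof of the crux must use the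
box geometry of `ℤ³` beyond finiteness, connectedness and the graph-uniform supports of the route. [folklore] -/
theorem not_graphUniformStrandsJoin :
    ¬ ∃ c : ℝ, 0 < c ∧ ∀ (V : Type) [Fintype V] [DecidableEq V] (G : SimpleGraph V) [DecidableRel G.Adj]
      (a : Fin 4 → V), Function.Injective a →
      (let t : ℝ := Real.tanh (criticalBeta 3);
       c * loopO1PartitionFunction G t {a 0, a 1} * loopO1PartitionFunction G t {a 2, a 3} ≤
        ∑ F₁ ∈ tJoins G Set.univ {a 0, a 1}, ∑ F₂ ∈ tJoins G Set.univ {a 2, a 3},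
          if (SimpleGraph.fromEdgeSet ((↑F₁ : Set (Sym2 V)) ∪ ↑F₂)).Reachable (a 0) (a 2)
            then t ^ (#F₁ + #F₂) else 0) :=
  not_graphUniformStrandsJoin_at tanh_criticalBeta_pos

end Summit.CriticalPhenomena.Ising3DConformalLimit.Cruxes.IndependentStrandsJoin.Disproof

end
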